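import Summits.NavierStokesRegularity.JiaSverakCAP.GS17SpectrumAtZeroVector
import HarnessLib

/-!
# Guillod–Šverák Thm 2.1 (1), erratum E2 — part 3: the components of `v = ∇Φ × e₃` ARE the
# `swirlComp`s, and `v` is divergence-free on `ℝ³ ∖ {0}` (`JiaSverakCAP.GS17SpectrumAtZero`, continued)

HONEST FRAMING (papers lane (c), PF-P2 writer seat papers-pfp2-w1 g3; companion of the tree modules
`GS17SpectrumAtZero` (p477988, step (i)) and `GS17SpectrumAtZeroVector` (p479601, steps (ii)–(iii) componentwise)).
Pure calculus on `EuclideanSpace ℝ (Fin 3)`; asserts NOTHING about Navier–Stokes, the cell's profile `Ũ`, its window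
eigenvalue or non-uniqueness. It kernel-checks two of the items that the PF-P2 draft v5 (§9 E2, wording R-v5-1) lists as
"by hand": (a) the IDENTIFICATION of the Cartesian components of `v = ∇Φ × e₃` with the functions `swirlComp` of part 2 —
`∂_a Φ(x) = DΦ(x)[a] = 2 g'(‖x‖²)⟪x, a⟫ = swirlComp a x` for `x ≠ 0` (`fderiv_coulombGauss3_eq_swirlComp`), so that
`v = (∂₂Φ, −∂₁Φ, 0) = (swirlComp e₂, −swirlComp e₁, 0)`; (b) the DIV-FREE clause of step (iii): the derivative
`D(swirlComp a)(x)[b] = 2g'(‖x‖²)⟪a, b⟫ + 4g''(‖x‖²)⟪x, a⟫⟪x, b⟫` is SYMMETRIC in `(a, b)`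
(`fderiv_swirlComp_apply`, `fderiv_swirlComp_symm`), hence `div v = ∂₁v₁ + ∂₂v₂ + ∂₃v₃ =
D(swirlComp e₂)[e₁] − D(swirlComp e₁)[e₂] + 0 = 0` on `ℝ³ ∖ {0}` (`swirl_div_eq_zero`), and the same for the image
`½ v` of `v` under the scalar operator (`half_swirl_div_eq_zero`) — which is why the pressure in `𝓛(0)v` can be taken
to be zero in step (iii). STILL NOT kernel-checked after this module: the extension of `v` across `x = 0` (the Lean
functions carry junk values at `0`), the membership `v ∈ 𝒟` (`L² ∩ L⁴` decay of `v`, `∂^α v`, `x·∇v`), and the reading of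
the printed operator as an identity on its printed domain (arXiv:1704.00560v1 only; journal text unread, acq-11911).
[folklore]
-/

open scoped BigOperators RealInnerProductSpace
open Set

noncomputable section

namespace Summit.NavierStokesRegularity.JiaSverakCAP.GS17SpectrumAtZero

/-- **(a) The components of `∇Φ` are the `swirlComp`s**: `DΦ(x)[a] = swirlComp a x` for `x ≠ 0`,
`Φ = coulombGauss3 = erf(‖x‖/2)/‖x‖`. Hence `v = ∇Φ × e₃ = (∂₂Φ, −∂₁Φ, 0) = (swirlComp e₂, −swirlComp e₁, 0)` on
`ℝ³ ∖ {0}`. [folklore] -/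
theorem fderiv_coulombGauss3_eq_swirlComp {x : EuclideanSpace ℝ (Fin 3)} (hx : x ≠ 0) (a : EuclideanSpace ℝ (Fin 3)) :
    fderiv ℝ coulombGauss3 x a = swirlComp a x := by
  have hs : 0 < ‖x‖ ^ 2 := by positivity
  have h := Literature.Analysis.FluidPDE.fderiv_comp_norm_sq_apply
    (E := EuclideanSpace ℝ (Fin 3)) (hasDerivAt_coulombGaussSq hs) a
  change fderiv ℝ (fun w : EuclideanSpace ℝ (Fin 3) => coulombGaussSq (‖w‖ ^ 2)) x a = _
  rw [h, swirlComp]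

/-- **The derivative of a component**: `D(swirlComp a)(x)[b] = 2g'(‖x‖²)⟪a,b⟫ + 4g''(‖x‖²)⟪x,a⟫⟪x,b⟫`
(`g = coulombGaussSq`, `x ≠ 0`). [folklore] -/
theorem fderiv_swirlComp_apply {x : EuclideanSpace ℝ (Fin 3)} (hx : x ≠ 0) (a b : EuclideanSpace ℝ (Fin 3)) :
    fderiv ℝ (swirlComp a) x b =
      2 * coulombGaussSqD1 (‖x‖ ^ 2) * ⟪a, b⟫ + 4 * coulombGaussSqD2 (‖x‖ ^ 2) * ⟪x, a⟫ * ⟪x, b⟫ := by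
  have hs : 0 < ‖x‖ ^ 2 := by positivity
  have hg : HasDerivAt (fun s : ℝ => 2 * coulombGaussSqD1 s) (2 * coulombGaussSqD2 (‖x‖ ^ 2)) (‖x‖ ^ 2) :=
    (hasDerivAt_coulombGaussSqD1 hs).const_mul 2
  have h := fderiv_comp_norm_sq_mul_inner_apply (E := EuclideanSpace ℝ (Fin 3)) hg a b
  change fderiv ℝ (fun w : EuclideanSpace ℝ (Fin 3) => 2 * coulombGaussSqD1 (‖w‖ ^ 2) * ⟪w, a⟫) x b = _
  rw [h]
  ring

/-- **Symmetry**: `D(swirlComp a)(x)[b] = D(swirlComp b)(x)[a]` (`x ≠ 0`). [folklore] -/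
theorem fderiv_swirlComp_symm {x : EuclideanSpace ℝ (Fin 3)} (hx : x ≠ 0) (a b : EuclideanSpace ℝ (Fin 3)) :
    fderiv ℝ (swirlComp a) x b = fderiv ℝ (swirlComp b) x a := by
  rw [fderiv_swirlComp_apply hx, fderiv_swirlComp_apply hx, real_inner_comm a b]
  ring

/-- **(b) `v = ∇Φ × e₃` is divergence-free on `ℝ³ ∖ {0}`**: with `v = (swirlComp e₂, −swirlComp e₁, 0)`,
`div v (x) = D(swirlComp e₂)(x)[e₁] − D(swirlComp e₁)(x)[e₂] + 0 = 0`; stated for an arbitrary pair `(a, b)` in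
place of `(e₂, e₁)`. [folklore] -/
theorem swirl_div_eq_zero {x : EuclideanSpace ℝ (Fin 3)} (hx : x ≠ 0) (a b : EuclideanSpace ℝ (Fin 3)) :
    fderiv ℝ (swirlComp a) x b - fderiv ℝ (swirlComp b) x a = 0 := by
  rw [fderiv_swirlComp_symm hx a b, sub_self]

/-- `swirlComp a` is differentiable at `x ≠ 0`. [folklore] -/
theorem differentiableAt_swirlComp {x : EuclideanSpace ℝ (Fin 3)} (hx : x ≠ 0) (a : EuclideanSpace ℝ (Fin 3)) :
    DifferentiableAt ℝ (swirlComp a) x := by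
  have hs : 0 < ‖x‖ ^ 2 := by positivity
  have hg : HasDerivAt (fun s : ℝ => 2 * coulombGaussSqD1 s) (2 * coulombGaussSqD2 (‖x‖ ^ 2)) (‖x‖ ^ 2) :=
    (hasDerivAt_coulombGaussSqD1 hs).const_mul 2
  have h := (hasFDerivAt_comp_norm_sq_mul_inner (E := EuclideanSpace ℝ (Fin 3)) hg a).differentiableAt
  exact h

/-- **The zero-pressure clause of step (iii)**: the image `½ v` of `v` under the scalar operator (parts 1–2) is again
divergence-free on `ℝ³ ∖ {0}`: `D(½ swirlComp a)(x)[b] − D(½ swirlComp b)(x)[a] = 0`. [folklore] -/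
theorem half_swirl_div_eq_zero {x : EuclideanSpace ℝ (Fin 3)} (hx : x ≠ 0) (a b : EuclideanSpace ℝ (Fin 3)) :
    fderiv ℝ (fun w => 1 / 2 * swirlComp a w) x b - fderiv ℝ (fun w => 1 / 2 * swirlComp b w) x a = 0 := by
  have ha : fderiv ℝ (fun w => 1 / 2 * swirlComp a w) x b = (1 / 2 : ℝ) * fderiv ℝ (swirlComp a) x b := by
    rw [fderiv_const_mul (differentiableAt_swirlComp hx a)]; rfl
  have hb : fderiv ℝ (fun w => 1 / 2 * swirlComp b w) x a = (1 / 2 : ℝ) * fderiv ℝ (swirlComp b) x a := by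
    rw [fderiv_const_mul (differentiableAt_swirlComp hx b)]; rfl
  rw [ha, hb, fderiv_swirlComp_symm hx a b, sub_self]

/-- The components in coordinates: with `e i := EuclideanSpace.single i 1`, `swirlComp (e i) x = 2 g'(‖x‖²) · x i` —
so `v₁ = swirlComp (e 1)`, `v₂ = −swirlComp (e 0)` are the pure-swirl field `2g'(‖x‖²)·(x₂, −x₁, 0)` of the draft.
[folklore] -/
theorem swirlComp_single (i : Fin 3) (x : EuclideanSpace ℝ (Fin 3)) :
    swirlComp (EuclideanSpace.single i (1 : ℝ)) x = 2 * coulombGaussSqD1 (‖x‖ ^ 2) * x i := by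
  rw [swirlComp, EuclideanSpace.inner_single_right]
  simp

end Summit.NavierStokesRegularity.JiaSverakCAP.GS17SpectrumAtZero

end
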